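import Literature.NumberTheory.Automorphic.MirabolicTowerGroups
import Literature.NumberTheory.Automorphic.GLnAdelicIntegrationFactsProofs
import Literature.MeasureTheory.Group.InvariantQuotientExistence
import HarnessLib

/-!
# The groups `H_m`, `H'_m` of the Fourier–Whittaker tower are unimodular; invariant measures on
`GL_n(𝔸_K) ⧸ H_m`, `GL_n(𝔸_K) ⧸ H'_m`
(Jacquet–Shalika (1981), §4; Cogdell (2004), §2.3: the quotient measures of the unfolding)

Topic `NumberTheory/Automorphic`; namespace `Literature.NumberTheory.Automorphic`. Sequel to
`MirabolicTowerGroups`. For a closed subgroup `S` of `GL_n(𝔸_K)` squeezed between the unipotent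
group `U^{(m)}(𝔸_K) = U_{[m,n-1]}(𝔸_K)` and `H'_m = diag(GL_m(K), 1) U^{(m)}(𝔸_K)` — so `S = H_m` or
`S = H'_m` — we prove:

* `subgroupRatPoints n K S` (**definition**: `S ∩ GL_n(K)`, a countable subgroup of `S`) and `towerBox n K m S`
  (**definition**: the elements of `S` lying in `U^{(m)}(𝔸_K)` with entries above the diagonal in
  Tate's fundamental domain);
* `existsUnique_smul_mem_towerBox` — **every `s ∈ S` has exactly one left `S(K)`-translate in the
  box** (decompose `s = diag(γ_𝔸, 1) u`, `MirabolicTowerGroups`, and move `u` into Tate's box by the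
  unique element of `U^{(m)}(K)`, `UnipotentColumnRange`), so the box is a measurable fundamental
  domain of finite, non-zero Haar measure (`isFundamentalDomain_towerBox`);
* `isMulRightInvariant_of_isHaarMeasure_towerSub`, `isInvInvariant_of_isHaarMeasure_towerSub` —
  **`S` is unimodular** (a locally compact group with a finite-covolume lattice is unimodular,
  `LatticeUnimodular`), in particular `H_m` and `H'_m` are;
* `exists_smulInvariantMeasure_quotient_towerSub` — **there is a non-zero `GL_n(𝔸_K)`-invariant Borel
  measure, finite on compact sets, on `GL_n(𝔸_K) ⧸ S`** (`GL_n(𝔸_K)` is unimodular,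
  `GLn.isMulRightInvariant_of_isHaarMeasure_adelic_holds`; existence of invariant quotient measures
  in the unimodular case, `InvariantQuotientExistence`).

These are the measures against which the stage identities of the tower are integrated
(`InvariantQuotientChainRule`).

## References

* H. Jacquet, J. A. Shalika, Amer. J. Math. 103 (1981), §4 [JacquetShalikaAJM1981].
* A. Deitmar, S. Echterhoff, *Principles of Harmonic Analysis*, 2nd ed. (2014), Thm. 1.5.3
  [DeitmarEchterhoff2014].
* M. S. Raghunathan, *Discrete subgroups of Lie groups* (1972), Ch. I, Remark 1.9.
-/

noncomputable section

open scoped Matrix MatrixGroups Pointwise ENNReal NNReal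
open NumberField IsDedekindDomain Matrix Set MeasureTheory MeasureTheory.Measure
open Literature.LinearAlgebra.Matrix

namespace Literature.NumberTheory.Automorphic

section TowerSub

variable (n : ℕ) (K : Type) [Field K] [NumberField K] (m : ℕ)

/-! ### Rational points and Tate's box inside `S` -/

/-- **The rational points `S(K) = S ∩ GL_n(K)`** of a subgroup `S ≤ GL_n(𝔸_K)` (diagonally embedded),
as a subgroup of `S`. [folklore] -/
def subgroupRatPoints (S : Subgroup (GL (Fin n) (AdeleRing (𝓞 K) K))) : Subgroup S :=
  ((AdelicGroupData.gl n K).arithmeticSubgroup).comap S.subtype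

variable {n K m}

/-- Membership in `subgroupRatPoints`: the element is the diagonal image of a rational matrix. [folklore] -/
theorem mem_subgroupRatPoints_iff {S : Subgroup (GL (Fin n) (AdeleRing (𝓞 K) K))} (x : S) :
    x ∈ subgroupRatPoints n K S ↔ ∃ δ : GL (Fin n) K, ratGL K δ = x :=
  Iff.rfl

/-- `S(K)` is countable (it injects into `GL_n(K)`). [folklore] -/
instance countable_subgroupRatPoints (S : Subgroup (GL (Fin n) (AdeleRing (𝓞 K) K))) :
    Countable (subgroupRatPoints n K S) := by
  haveI : Countable (GL (Fin n) K) := countable_generalLinearGroup_numberField n K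
  choose δ hδ using fun x : subgroupRatPoints n K S => (mem_subgroupRatPoints_iff (x : S)).1 x.2
  have hinj : Function.Injective δ := by
    intro x y h
    apply Subtype.ext; apply Subtype.ext
    rw [← hδ x, ← hδ y, h]
  exact hinj.countable

variable (n K m) in
/-- **Tate's box of the unipotent part inside `S`**: the elements of `S` lying in
`U^{(m)}(𝔸_K) = U_{[m,n-1]}(𝔸_K)` all of whose entries above the diagonal lie in Tate's additive
fundamental domain (`colRangeTateDomain` seen in `S`). [cite: CasselsFrohlichANT1967, Ch. XV Thm. 4.1.3] -/
def towerBox (S : Subgroup (GL (Fin n) (AdeleRing (𝓞 K) K))) : Set S :=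
  {x | (x : GL (Fin n) (AdeleRing (𝓞 K) K)) ∈ adelicColRange n K m (n - 1) ∧
    ∀ i j : Fin n, i < j →
      ((x : GL (Fin n) (AdeleRing (𝓞 K) K)) : Matrix (Fin n) (Fin n) (AdeleRing (𝓞 K) K)) i j ∈
        adeleFundamentalDomain K}

/-- Membership in `towerBox` through `colRangeTateDomain`. [folklore] -/
theorem mem_towerBox_iff {S : Subgroup (GL (Fin n) (AdeleRing (𝓞 K) K))} (x : S) :
    x ∈ towerBox n K m S ↔ ∃ hx : (x : GL (Fin n) (AdeleRing (𝓞 K) K)) ∈ adelicColRange n K m (n - 1),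
      (⟨x, hx⟩ : adelicColRange n K m (n - 1)) ∈ colRangeTateDomain n K m (n - 1) := by
  constructor
  · rintro ⟨hx, hD⟩; exact ⟨hx, hD⟩
  · rintro ⟨hx, hD⟩; exact ⟨hx, hD⟩

/-- `ratGL` is multiplicative (restated for rewriting under the abbreviation). [folklore] -/
theorem ratGL_mul {k : ℕ} (γ γ' : GL (Fin k) K) : ratGL K (γ * γ') = ratGL K γ * ratGL K γ' := map_mul _ _ _

/-- `ratGL` commutes with inversion (restated for rewriting under the abbreviation). [folklore] -/
theorem ratGL_inv {k : ℕ} (γ : GL (Fin k) K) : ratGL K γ⁻¹ = (ratGL K γ)⁻¹ := map_inv _ _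

/-- **Unique representability**: for `U^{(m)}(𝔸_K) ≤ S ≤ H'_m`, every `x ∈ S` has exactly one left
`S(K)`-translate in the box. Write `x = diag(γ_𝔸, 1) u` (`exists_glCorner_ratGL_mul_eq`); the
translates of `x` in `U^{(m)}(𝔸_K)` are the `ρ u`, `ρ ∈ U^{(m)}(K)`, times nothing else (uniqueness of
the decomposition), and exactly one `ρ u` lies in Tate's box
(`existsUnique_smul_mem_colRangeTateDomain`). [cite: CasselsFrohlichANT1967, Ch. XV Thm. 4.1.3 (1)] -/
theorem existsUnique_smul_mem_towerBox (hm : m ≤ n) {S : Subgroup (GL (Fin n) (AdeleRing (𝓞 K) K))}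
    (hV : adelicColRange n K m (n - 1) ≤ S) (hS : S ≤ towerGroup' n K m) (x : S) :
    ∃! g : subgroupRatPoints n K S, g • x ∈ towerBox n K m S := by
  obtain ⟨γ, u, hu, hx⟩ := exists_glCorner_ratGL_mul_eq hm (hS x.2)
  obtain ⟨ρ, hρ, huniq⟩ := existsUnique_smul_mem_colRangeTateDomain (⟨u, hu⟩ : adelicColRange n K m (n - 1))
  obtain ⟨δρ, hδρ⟩ := (mem_rationalColRange_iff (ρ : adelicColRange n K m (n - 1))).1 ρ.2
  set c : GL (Fin n) (AdeleRing (𝓞 K) K) := glCorner (AdeleRing (𝓞 K) K) hm (ratGL K γ) with hc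
  have hcS : c ∈ S := by
    have : c = (x : GL (Fin n) (AdeleRing (𝓞 K) K)) * u⁻¹ := by rw [hx, mul_inv_cancel_right]
    rw [this]; exact S.mul_mem x.2 (S.inv_mem (hV hu))
  have hρS : ((ρ : adelicColRange n K m (n - 1)) : GL (Fin n) (AdeleRing (𝓞 K) K)) ∈ S := hV (ρ : adelicColRange n K m (n - 1)).2
  -- the translating element
  set g₀ : S := ⟨((ρ : adelicColRange n K m (n - 1)) : GL (Fin n) (AdeleRing (𝓞 K) K)) * c⁻¹,
    S.mul_mem hρS (S.inv_mem hcS)⟩ with hg₀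
  have hg₀rat : g₀ ∈ subgroupRatPoints n K S := by
    refine ⟨δρ * glCorner K hm γ⁻¹, ?_⟩
    change ratGL K (δρ * glCorner K hm γ⁻¹) = ((ρ : adelicColRange n K m (n - 1)) : GL (Fin n) (AdeleRing (𝓞 K) K)) * c⁻¹
    rw [ratGL_mul, ratGL_glCorner, ratGL_inv, map_inv, hc]
    exact congrArg (· * _) hδρ
  have hval : ∀ g : S, ((g • x : S) : GL (Fin n) (AdeleRing (𝓞 K) K)) =
      (g : GL (Fin n) (AdeleRing (𝓞 K) K)) * x := fun g => rfl
  have hg₀x : ((g₀ * x : S) : GL (Fin n) (AdeleRing (𝓞 K) K)) =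
      ((ρ : adelicColRange n K m (n - 1)) : GL (Fin n) (AdeleRing (𝓞 K) K)) * u := by
    rw [Subgroup.coe_mul, hg₀, hx]
    simp only [mul_assoc, inv_mul_cancel_left]
  refine ⟨⟨g₀, hg₀rat⟩, ?_, ?_⟩
  · -- `g₀ • x = ρ u` lies in the box
    change g₀ * x ∈ towerBox n K m S
    refine (mem_towerBox_iff _).2 ⟨?_, ?_⟩
    · rw [hg₀x]; exact (adelicColRange n K m (n - 1)).mul_mem (ρ : adelicColRange n K m (n - 1)).2 hu
    · convert hρ using 1
      exact Subtype.ext hg₀x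
  · -- uniqueness
    rintro ⟨g', hg'rat⟩ hg'
    change g' * x ∈ towerBox n K m S at hg'
    obtain ⟨hg'V, hg'D⟩ := (mem_towerBox_iff _).1 hg'
    apply Subtype.ext
    change g' = g₀
    -- `g' g₀⁻¹` is a rational element of `U^{(m)}(𝔸_K)`
    have hq : ((g' * g₀⁻¹ : S) : GL (Fin n) (AdeleRing (𝓞 K) K)) ∈ adelicColRange n K m (n - 1) := by
      have : ((g' * g₀⁻¹ : S) : GL (Fin n) (AdeleRing (𝓞 K) K)) =
          ((g' * x : S) : GL (Fin n) (AdeleRing (𝓞 K) K)) * (((g₀ * x : S) : GL (Fin n) (AdeleRing (𝓞 K) K)))⁻¹ := by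
        simp only [Subgroup.coe_mul, Subgroup.coe_inv, _root_.mul_inv_rev, mul_assoc, mul_inv_cancel_left]
      rw [this]
      exact (adelicColRange n K m (n - 1)).mul_mem hg'V ((adelicColRange n K m (n - 1)).inv_mem (by
        rw [hg₀x]; exact (adelicColRange n K m (n - 1)).mul_mem (ρ : adelicColRange n K m (n - 1)).2 hu))
    obtain ⟨δ', hδ'⟩ := (mem_subgroupRatPoints_iff _).1 hg'rat
    obtain ⟨δ₀, hδ₀⟩ := (mem_subgroupRatPoints_iff _).1 hg₀rat
    set q : adelicColRange n K m (n - 1) := ⟨((g' * g₀⁻¹ : S) : GL (Fin n) (AdeleRing (𝓞 K) K)), hq⟩ with hqdef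
    have hqrat : q ∈ rationalColRange n K m (n - 1) := by
      refine ⟨δ' * δ₀⁻¹, ?_⟩
      change ratGL K (δ' * δ₀⁻¹) = ((g' * g₀⁻¹ : S) : GL (Fin n) (AdeleRing (𝓞 K) K))
      rw [ratGL_mul, ratGL_inv, Subgroup.coe_mul, Subgroup.coe_inv, hδ', hδ₀]
    -- both `ρ u` and `(q ρ) u` lie in the box
    have h1 : (⟨q, hqrat⟩ * ρ : rationalColRange n K m (n - 1)) • (⟨u, hu⟩ : adelicColRange n K m (n - 1)) ∈
        colRangeTateDomain n K m (n - 1) := by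
      convert hg'D using 1
      apply Subtype.ext
      change ((g' * g₀⁻¹ : S) : GL (Fin n) (AdeleRing (𝓞 K) K)) *
          ((ρ : adelicColRange n K m (n - 1)) : GL (Fin n) (AdeleRing (𝓞 K) K)) * u =
        ((g' * x : S) : GL (Fin n) (AdeleRing (𝓞 K) K))
      rw [mul_assoc, ← hg₀x, Subgroup.coe_mul, Subgroup.coe_mul, Subgroup.coe_mul, Subgroup.coe_inv,
        mul_assoc, inv_mul_cancel_left]
    have h2 := huniq _ h1
    have hq1 : (⟨q, hqrat⟩ : rationalColRange n K m (n - 1)) = 1 := mul_eq_right.1 h2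
    have : ((g' * g₀⁻¹ : S) : GL (Fin n) (AdeleRing (𝓞 K) K)) = 1 := by
      have := congrArg (fun r : rationalColRange n K m (n - 1) =>
        ((r : adelicColRange n K m (n - 1)) : GL (Fin n) (AdeleRing (𝓞 K) K))) hq1
      exact this
    have h3 : g' * g₀⁻¹ = 1 := Subtype.ext this
    exact mul_inv_eq_one.1 h3

/-! ### The box is a fundamental domain of finite non-zero Haar measure; unimodularity -/

variable [MeasurableSpace (GL (Fin n) (AdeleRing (𝓞 K) K))] [BorelSpace (GL (Fin n) (AdeleRing (𝓞 K) K))]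

/-- The box is a Borel subset of `S` (`U^{(m)}(𝔸_K)` is closed; continuous entries, `D` Borel).
[folklore] -/
theorem measurableSet_towerBox (S : Subgroup (GL (Fin n) (AdeleRing (𝓞 K) K))) :
    MeasurableSet (towerBox n K m S) := by
  borelize (AdeleRing (𝓞 K) K)
  have : towerBox n K m S = (Subtype.val ⁻¹' (adelicColRange n K m (n - 1) : Set (GL (Fin n) (AdeleRing (𝓞 K) K)))) ∩
      ⋂ i : Fin n, ⋂ j : Fin n, ⋂ (_ : i < j),
        (fun x : S => ((x : GL (Fin n) (AdeleRing (𝓞 K) K)) : Matrix (Fin n) (Fin n) (AdeleRing (𝓞 K) K)) i j) ⁻¹'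
          adeleFundamentalDomain K := by
    ext x
    simp only [towerBox, mem_setOf_eq, mem_inter_iff, mem_preimage, SetLike.mem_coe, mem_iInter]
  rw [this]
  refine ((isClosed_adelicColRange n K m (n - 1)).measurableSet.preimage measurable_subtype_coe).inter
    (MeasurableSet.iInter fun i => MeasurableSet.iInter fun j => MeasurableSet.iInter fun _ => ?_)
  exact ((continuous_gl_apply i j).comp continuous_subtype_val).measurable (measurableSet_adeleFundamentalDomain K)

/-- **The box is a measurable fundamental domain** for the left multiplication action of `S(K)` on
`S`, for every measure (`U^{(m)}(𝔸_K) ≤ S ≤ H'_m`). [cite: CasselsFrohlichANT1967, Ch. XV Thm. 4.1.3 (1)] -/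
theorem isFundamentalDomain_towerBox (hm : m ≤ n) {S : Subgroup (GL (Fin n) (AdeleRing (𝓞 K) K))}
    (hV : adelicColRange n K m (n - 1) ≤ S) (hS : S ≤ towerGroup' n K m) (μ : Measure S) :
    IsFundamentalDomain (subgroupRatPoints n K S) (towerBox n K m S) μ :=
  IsFundamentalDomain.mk' (measurableSet_towerBox S).nullMeasurableSet (existsUnique_smul_mem_towerBox hm hV hS)

omit [MeasurableSpace (GL (Fin n) (AdeleRing (𝓞 K) K))] [BorelSpace (GL (Fin n) (AdeleRing (𝓞 K) K))] in
/-- The box is the image of `colRangeTateDomain` under the inclusion `U^{(m)}(𝔸_K) ↪ S`. [folklore] -/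
theorem towerBox_eq_image {S : Subgroup (GL (Fin n) (AdeleRing (𝓞 K) K))}
    (hV : adelicColRange n K m (n - 1) ≤ S) :
    towerBox n K m S = Subgroup.inclusion hV '' colRangeTateDomain n K m (n - 1) := by
  ext x
  rw [mem_towerBox_iff, Set.mem_image]
  constructor
  · rintro ⟨hx, hD⟩
    exact ⟨⟨x, hx⟩, hD, Subtype.ext rfl⟩
  · rintro ⟨u, hu, rfl⟩
    exact ⟨u.2, hu⟩

omit [MeasurableSpace (GL (Fin n) (AdeleRing (𝓞 K) K))] [BorelSpace (GL (Fin n) (AdeleRing (𝓞 K) K))] in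
/-- The box has compact closure in `S`. [folklore] -/
theorem isCompact_closure_towerBox {S : Subgroup (GL (Fin n) (AdeleRing (𝓞 K) K))}
    (hV : adelicColRange n K m (n - 1) ≤ S) : IsCompact (closure (towerBox n K m S)) := by
  haveI := t2Space_adeleRing K
  have hcont : Continuous (Subgroup.inclusion hV) :=
    Continuous.subtype_mk continuous_subtype_val _
  have h1 : IsCompact (Subgroup.inclusion hV '' closure (colRangeTateDomain n K m (n - 1))) :=
    isCompact_closure_colRangeTateDomain.image hcont
  refine h1.of_isClosed_subset isClosed_closure (closure_minimal ?_ h1.isClosed)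
  rw [towerBox_eq_image hV]
  exact Set.image_mono subset_closure

omit [BorelSpace (GL (Fin n) (AdeleRing (𝓞 K) K))] in
/-- The box has finite measure for every measure finite on compact sets. [folklore] -/
theorem measure_towerBox_lt_top {S : Subgroup (GL (Fin n) (AdeleRing (𝓞 K) K))}
    (hV : adelicColRange n K m (n - 1) ≤ S) (μ : Measure S) [IsFiniteMeasureOnCompacts μ] :
    μ (towerBox n K m S) < ⊤ :=
  (measure_mono subset_closure).trans_lt (isCompact_closure_towerBox hV).measure_lt_top

/-- The box has non-zero measure for every non-zero `S(K)`-invariant measure, in particular for left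
Haar measures (a fundamental domain of a countable group cannot be null). [folklore] -/
theorem measure_towerBox_ne_zero (hm : m ≤ n) {S : Subgroup (GL (Fin n) (AdeleRing (𝓞 K) K))}
    (hV : adelicColRange n K m (n - 1) ≤ S) (hS : S ≤ towerGroup' n K m) (μ : Measure S)
    [μ.IsMulLeftInvariant] (hμ : μ ≠ 0) : μ (towerBox n K m S) ≠ 0 :=
  (isFundamentalDomain_towerBox hm hV hS μ).measure_ne_zero hμ

/-- **`S` is unimodular** for `U^{(m)}(𝔸_K) ≤ S ≤ H'_m` closed: every Haar measure on `S` is right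
invariant — `S` carries the countable subgroup `S(K)` with a fundamental domain of finite non-zero
measure (`LatticeUnimodular.isMulRightInvariant_of_isFundamentalDomain`; Raghunathan (1972), I.1.9).
In particular `H_m` and `H'_m` are unimodular. [folklore] -/
theorem isMulRightInvariant_of_isHaarMeasure_towerSub (hm : m ≤ n)
    {S : Subgroup (GL (Fin n) (AdeleRing (𝓞 K) K))} (hV : adelicColRange n K m (n - 1) ≤ S)
    (hS : S ≤ towerGroup' n K m) (hSc : IsClosed (S : Set (GL (Fin n) (AdeleRing (𝓞 K) K))))
    (μ : Measure S) [IsHaarMeasure μ] : μ.IsMulRightInvariant := by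
  haveI := t2Space_adeleRing K
  haveI : LocallyCompactSpace (GL (Fin n) (AdeleRing (𝓞 K) K)) :=
    AdelicGroupData.locallyCompactSpace_generalLinearGroup_adeleRing K (Fin n)
  haveI := secondCountableTopology_generalLinearGroup_adeleRing K (Fin n)
  haveI : LocallyCompactSpace S := hSc.isClosedEmbedding_subtypeVal.locallyCompactSpace
  haveI : SecondCountableTopology S := TopologicalSpace.Subtype.secondCountableTopology _
  haveI : PolishSpace S :=
    Literature.Topology.Metrizable.polishSpace_of_locallyCompactSpace_of_secondCountableTopology _
  have hμ0 : μ ≠ 0 := fun h0 => by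
    have := isOpen_univ.measure_ne_zero μ Set.univ_nonempty
    rw [h0] at this
    exact this rfl
  exact isMulRightInvariant_of_isFundamentalDomain (subgroupRatPoints n K S) μ
    (isFundamentalDomain_towerBox hm hV hS μ) (measure_towerBox_ne_zero hm hV hS μ hμ0)
    (measure_towerBox_lt_top hV μ).ne

/-- Hence **Haar measures on `S` are inversion invariant** (`isInvInvariant_of_isMulRightInvariant`).
[folklore] -/
theorem isInvInvariant_of_isHaarMeasure_towerSub (hm : m ≤ n)
    {S : Subgroup (GL (Fin n) (AdeleRing (𝓞 K) K))} (hV : adelicColRange n K m (n - 1) ≤ S)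
    (hS : S ≤ towerGroup' n K m) (hSc : IsClosed (S : Set (GL (Fin n) (AdeleRing (𝓞 K) K))))
    (μ : Measure S) [IsHaarMeasure μ] : μ.IsInvInvariant := by
  haveI := t2Space_adeleRing K
  haveI : LocallyCompactSpace (GL (Fin n) (AdeleRing (𝓞 K) K)) :=
    AdelicGroupData.locallyCompactSpace_generalLinearGroup_adeleRing K (Fin n)
  haveI := secondCountableTopology_generalLinearGroup_adeleRing K (Fin n)
  haveI : LocallyCompactSpace S := hSc.isClosedEmbedding_subtypeVal.locallyCompactSpace
  haveI : SecondCountableTopology S := TopologicalSpace.Subtype.secondCountableTopology _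
  haveI := isMulRightInvariant_of_isHaarMeasure_towerSub hm hV hS hSc μ
  exact isInvInvariant_of_isMulRightInvariant μ

/-! ### Invariant measures on `GL_n(𝔸_K) ⧸ S` -/

/-- **A non-zero invariant measure on `GL_n(𝔸_K) ⧸ S`** (`U^{(m)}(𝔸_K) ≤ S ≤ H'_m`, `S` closed, in
particular `S = H_m`, `H'_m`): there is a `GL_n(𝔸_K)`-invariant Borel measure on the coset space,
finite on compact sets and non-zero — `GL_n(𝔸_K)` is unimodular
(`GLn.isMulRightInvariant_of_isHaarMeasure_adelic_holds`) and `S` is unimodular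
(`isInvInvariant_of_isHaarMeasure_towerSub`), so the existence theorem for invariant quotient
measures (`Literature.MeasureTheory.Group.exists_smulInvariantMeasure_integral_fiberIntegral_eq`,
Deitmar–Echterhoff Thm. 1.5.3) applies. [cite: DeitmarEchterhoff2014, Thm. 1.5.3] -/
theorem exists_smulInvariantMeasure_quotient_towerSub (hm : m ≤ n)
    {S : Subgroup (GL (Fin n) (AdeleRing (𝓞 K) K))} (hV : adelicColRange n K m (n - 1) ≤ S)
    (hS : S ≤ towerGroup' n K m) (hSc : IsClosed (S : Set (GL (Fin n) (AdeleRing (𝓞 K) K))))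
    [MeasurableSpace (GL (Fin n) (AdeleRing (𝓞 K) K) ⧸ S)] [BorelSpace (GL (Fin n) (AdeleRing (𝓞 K) K) ⧸ S)] :
    ∃ μ : Measure (GL (Fin n) (AdeleRing (𝓞 K) K) ⧸ S),
      SMulInvariantMeasure (GL (Fin n) (AdeleRing (𝓞 K) K)) (GL (Fin n) (AdeleRing (𝓞 K) K) ⧸ S) μ ∧
        IsFiniteMeasureOnCompacts μ ∧ μ ≠ 0 := by
  borelize (GL (Fin n) (AdeleRing (𝓞 K) K))
  haveI := t2Space_adeleRing K
  haveI : LocallyCompactSpace (GL (Fin n) (AdeleRing (𝓞 K) K)) :=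
    AdelicGroupData.locallyCompactSpace_generalLinearGroup_adeleRing K (Fin n)
  haveI := secondCountableTopology_generalLinearGroup_adeleRing K (Fin n)
  haveI : LocallyCompactSpace S := hSc.isClosedEmbedding_subtypeVal.locallyCompactSpace
  haveI : SecondCountableTopology S := TopologicalSpace.Subtype.secondCountableTopology _
  -- Haar measures on `S` (inversion invariant) and on `GL_n(𝔸_K)` (right invariant)
  obtain ⟨ρ, hρ⟩ : ∃ ρ : Measure S, IsHaarMeasure ρ := ⟨Measure.haar, inferInstance⟩
  haveI := isInvInvariant_of_isHaarMeasure_towerSub hm hV hS hSc ρ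
  obtain ⟨ν, hν⟩ : ∃ ν : Measure (GL (Fin n) (AdeleRing (𝓞 K) K)), IsHaarMeasure ν := ⟨Measure.haar, inferInstance⟩
  haveI : ν.IsMulRightInvariant := GLn.isMulRightInvariant_of_isHaarMeasure_adelic_holds n K ν hν
  obtain ⟨μ, hinv, hreg, hne, -⟩ :=
    Literature.MeasureTheory.Group.exists_smulInvariantMeasure_integral_fiberIntegral_eq S ρ hSc ν
  haveI := hreg
  exact ⟨μ, hinv, inferInstance, hne⟩

/-- The same for `H_m` (`1 ≤ m ≤ n`). [cite: DeitmarEchterhoff2014, Thm. 1.5.3] -/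
theorem exists_smulInvariantMeasure_quotient_towerGroup (hm : m ≤ n)
    [MeasurableSpace (GL (Fin n) (AdeleRing (𝓞 K) K) ⧸ towerGroup n K m)]
    [BorelSpace (GL (Fin n) (AdeleRing (𝓞 K) K) ⧸ towerGroup n K m)] :
    ∃ μ : Measure (GL (Fin n) (AdeleRing (𝓞 K) K) ⧸ towerGroup n K m),
      SMulInvariantMeasure (GL (Fin n) (AdeleRing (𝓞 K) K)) (GL (Fin n) (AdeleRing (𝓞 K) K) ⧸ towerGroup n K m) μ ∧
        IsFiniteMeasureOnCompacts μ ∧ μ ≠ 0 :=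
  exists_smulInvariantMeasure_quotient_towerSub hm (adelicColRange_le_towerGroup (n - 1))
    towerGroup_le_towerGroup' isClosed_towerGroup

/-- The same for `H'_m` (`m ≤ n`). [cite: DeitmarEchterhoff2014, Thm. 1.5.3] -/
theorem exists_smulInvariantMeasure_quotient_towerGroup' (hm : m ≤ n)
    [MeasurableSpace (GL (Fin n) (AdeleRing (𝓞 K) K) ⧸ towerGroup' n K m)]
    [BorelSpace (GL (Fin n) (AdeleRing (𝓞 K) K) ⧸ towerGroup' n K m)] :
    ∃ μ : Measure (GL (Fin n) (AdeleRing (𝓞 K) K) ⧸ towerGroup' n K m),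
      SMulInvariantMeasure (GL (Fin n) (AdeleRing (𝓞 K) K)) (GL (Fin n) (AdeleRing (𝓞 K) K) ⧸ towerGroup' n K m) μ ∧
        IsFiniteMeasureOnCompacts μ ∧ μ ≠ 0 :=
  exists_smulInvariantMeasure_quotient_towerSub hm (adelicColRange_le_towerGroup' (n - 1)) le_rfl
    isClosed_towerGroup'

end TowerSub

end Literature.NumberTheory.Automorphic
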